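import Summits.ValiantsHypothesis.ValiantsHypothesis.Theorems.LacunarySymmetroidMatrixDescartesCensusDoorA34HollowCornerIsotropic

/-!
# `MatrixDescartes` census — DOOR A at `(3,4)`: `DoorA34` ⟺ the SIGNED hollow-corner rows (`εᵢ = ±1`: the three generic node classes
# R4 / R2 / R0 only), support by support

HONEST FRAMING.  Object-search cell `pub-symmetroid`, door-A seat `val-sym-door-p3` (g18); item stmt-ValiantsHypothesis-19980
`DoorA34 = PosRootLawAt 3 4 18` is OPEN and asserted nowhere in this file.  The theorems are EQUIVALENCES between the door (and each of its
support rows `PosRootLawOn 3 4 18 d`) and an explicit family of fewnomial rows, which is NOT bounded here.  Nothing bounds `ζ_sym(3,4)`;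
nothing bears on `MatrixDescartes` (stmt-ValiantsHypothesis-18050) or on `VP ≠ VNP`.

CONTENT (all supports; no `def`, no `sorry`).
* `posRootLawOn_of_rows_off_hypersurface` — the support-level form of `DenseRows.posRootLawAt_iff_rows_off_hypersurface`;
* **`exists_congr_signedHollowCorner`** — off ONE hypersurface `Θ = Φ·Ψ = 0` (`Φ` = generic polynomial of `…ChartAtlas`, `Ψ` = coordinate
  determinant of `…HollowCornerIsotropic`) every symmetric four-letter tuple is congruent to a hollow-corner net with `ε₁, ε₂ ∈ {1, −1}`
  (`annihilator_dichotomy` + the two chart theorems + `false_of_isotropic_hollowCorner_congr`);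
* **`posRootLawOn_iff_signedHollowCornerRows`** (every `d`): `PosRootLawOn 3 4 18 d ↔ ∀ ε₁ ε₂ u w α β, εᵢ = ±1 → Z₊ ≤ 18` for the
  hollow-corner pencil on `d`; **`doorA34_iff_signedHollowCornerRows`**; `not_doorA34_iff_signedHollowCornerNineteen`.
The three classes: `(1,1)` = R4 (`det = ½·e₃(u−α, u+α, w−β, w+β)`, four real nodes), `(1,−1) ~ (−1,1)` = R2 (`w(u²−α²) − u(w²+β²)`),
`(−1,−1)` = R0 (`−(w(u²+α²) + u(w²+β²))`, traceless net).
[folklore] Pencils of conics / Cayley's four-nodal cubic symmetroid; elementary.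
-/

-- `Summit.ValiantsHypothesis.ValiantsHypothesis.…` repeats a component by the D-0017 layout
-- (single-conjunct summit), which the `dupNamespace` linter flags; the name is mandated.
set_option linter.dupNamespace false

namespace Summit.ValiantsHypothesis.ValiantsHypothesis.Theorems.LacunarySymmetroidMatrixDescartes.Census.EqualDiagonal

open Matrix Finset
open scoped BigOperators

/-! ## 20. `DoorA34` ⟺ the SIGNED hollow-corner rows (three generic node classes) — support by support -/

section Signed

open Polynomial
open Summit.ValiantsHypothesis.ValiantsHypothesis.Theorems.MatrixDescartes.Negative (PosRootLawAt)

/-- **A sharp `(3,4)` row is decided off any proper algebraic hypersurface — support level.**  For any polynomial `Φ` in the `36` entry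
variables not vanishing at some symmetric tuple, `PosRootLawOn 3 4 18 d` holds as soon as every symmetric tuple `S` with `Φ(S) ≠ 0`
has `≤ 18` distinct positive det-roots on `d` (`DenseRows.posRootLawOn_of_denseRows` + `DenseRows.exists_symm_near_eval_ne_zero`).
[folklore] -/
theorem posRootLawOn_of_rows_off_hypersurface (d : Fin 4 → ℕ) (Φ : MvPolynomial (Fin 4 × Fin 3 × Fin 3) ℝ)
    (hΦ : ∃ S₀ : Fin 4 → Matrix (Fin 3) (Fin 3) ℝ, (∀ l, (S₀ l).IsSymm) ∧
      MvPolynomial.eval (fun idx : Fin 4 × Fin 3 × Fin 3 => S₀ idx.1 idx.2.1 idx.2.2) Φ ≠ 0)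
    (h : ∀ S : Fin 4 → Matrix (Fin 3) (Fin 3) ℝ, (∀ l, (S l).IsSymm) →
      MvPolynomial.eval (fun idx : Fin 4 × Fin 3 × Fin 3 => S idx.1 idx.2.1 idx.2.2) Φ ≠ 0 →
        ((∑ l, (X : ℝ[X]) ^ d l • (S l).map C).det.roots.toFinset.filter (fun x => 0 < x)).card ≤ 18) :
    PosRootLawOn 3 4 18 d := by
  refine DenseRows.posRootLawOn_of_denseRows (by decide) d
    {S | MvPolynomial.eval (fun idx : Fin 4 × Fin 3 × Fin 3 => S idx.1 idx.2.1 idx.2.2) Φ ≠ 0} ?_ ?_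
  · intro S hS U hU hSU
    obtain ⟨S', hS'U, hS'symm, hS'Φ⟩ := DenseRows.exists_symm_near_eval_ne_zero Φ hΦ S hS U hU hSU
    exact ⟨S', hS'Φ, hS'symm, hS'U⟩
  · intro S hSΦ hS
    exact h S hS hSΦ

/-- **Generic nets are congruent to a SIGNED hollow-corner net (`εᵢ = ±1`).**  Off the hypersurface `Φ·Ψ = 0` (`Φ` the generic polynomial
of `…ChartAtlas`: Cramer annihilators with `det B₁ ≠ 0` and non-zero discriminant; `Ψ` the coordinate determinant of §18: independent
letters) every symmetric four-letter tuple is congruent, by ONE invertible `P`, to a hollow-corner net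
`[[ε₁u_l + ε₂w_l, α_l, β_l], [α_l, u_l, 0], [β_l, 0, w_l]]` with `ε₁, ε₂ ∈ {1, −1}` — the isotropic values `εᵢ = 0` are excluded by
`false_of_isotropic_hollowCorner_congr`. [folklore] -/
theorem exists_congr_signedHollowCorner :
    ∃ Θ : MvPolynomial (Fin 4 × Fin 3 × Fin 3) ℝ,
      (∃ S₀ : Fin 4 → Matrix (Fin 3) (Fin 3) ℝ, (∀ l, (S₀ l).IsSymm) ∧
        MvPolynomial.eval (fun idx : Fin 4 × Fin 3 × Fin 3 => S₀ idx.1 idx.2.1 idx.2.2) Θ ≠ 0) ∧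
      ∀ S : Fin 4 → Matrix (Fin 3) (Fin 3) ℝ, (∀ l, (S l).IsSymm) →
        MvPolynomial.eval (fun idx : Fin 4 × Fin 3 × Fin 3 => S idx.1 idx.2.1 idx.2.2) Θ ≠ 0 →
        ∃ (P : Matrix (Fin 3) (Fin 3) ℝ) (ε₁ ε₂ : ℝ) (u w α β : Fin 4 → ℝ), P.det ≠ 0 ∧
          (ε₁ = 1 ∨ ε₁ = -1) ∧ (ε₂ = 1 ∨ ε₂ = -1) ∧
          ∀ l, S l = Pᵀ * !![ε₁ * u l + ε₂ * w l, α l, β l; α l, u l, 0; β l, 0, w l] * P := by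
  obtain ⟨Φ, hΦ₀, hΦ⟩ := exists_generic_polynomial
  obtain ⟨Ψ, hΨ₀, hΨ⟩ := coordDet_witness
  refine ⟨Φ * Ψ, exists_symm_witness_mul Φ Ψ hΦ₀ hΨ₀, fun S hS hne => ?_⟩
  rw [map_mul] at hne
  obtain ⟨B₁, B₂, hB₁, hB₂, hann₁, hann₂, hdet, hdisc⟩ := hΦ S hS (left_ne_zero_of_mul hne)
  have hind : ∀ c : Fin 4 → ℝ, ∑ l, c l • S l = 0 → c = 0 :=
    letters_independent_of_coordDet_ne_zero S (by rw [← hΨ S]; exact right_ne_zero_of_mul hne)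
  have key : ∃ (P : Matrix (Fin 3) (Fin 3) ℝ) (ε₁ ε₂ : ℝ) (u w α β : Fin 4 → ℝ), P.det ≠ 0 ∧
      (ε₁ = 1 ∨ ε₁ = 0 ∨ ε₁ = -1) ∧ (ε₂ = 1 ∨ ε₂ = 0 ∨ ε₂ = -1) ∧
      ∀ l, S l = Pᵀ * !![ε₁ * u l + ε₂ * w l, α l, β l; α l, u l, 0; β l, 0, w l] * P := by
    rcases annihilator_dichotomy B₁ B₂ hdet hdisc with ⟨μ, hμ, hroots⟩ | ⟨μ, hroot, huniq, hsimple⟩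
    · exact exists_congr_hollowCorner_of_split S hS B₁ B₂ hB₁ hB₂ hdet hann₁ hann₂ μ hμ hroots
    · exact exists_congr_hollowCorner_of_uniqueRoot S hS B₁ B₂ hB₁ hB₂ hdet hann₁ hann₂ μ hroot huniq hsimple
  obtain ⟨P, ε₁, ε₂, u, w, α, β, hP, hε₁, hε₂, hSP⟩ := key
  have hε : ε₁ * ε₂ ≠ 0 := fun h0 =>
    false_of_isotropic_hollowCorner_congr S hind P hP ε₁ ε₂ h0 u w α β hSP B₁ B₂ hB₁ hB₂ hdet hann₁ hann₂ hdisc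
  refine ⟨P, ε₁, ε₂, u, w, α, β, hP, ?_, ?_, hSP⟩
  · rcases hε₁ with h | h | h
    · exact Or.inl h
    · exact absurd (by rw [h, zero_mul]) hε
    · exact Or.inr h
  · rcases hε₂ with h | h | h
    · exact Or.inl h
    · exact absurd (by rw [h, mul_zero]) hε
    · exact Or.inr h

/-- **THE ROW `ζ(3,4; d) ≤ 18` IS THE SIGNED HOLLOW-CORNER ROWS ON `d` (support level).**  For every exponent vector `d`,
`PosRootLawOn 3 4 18 d` (every real symmetric `3 × 3` four-letter pencil on `d` has `≤ 18` distinct positive det-roots) holds IF AND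
ONLY IF for all signs `ε₁, ε₂ ∈ {1, −1}` and all coefficient data `u, w, α, β : Fin 4 → ℝ` the hollow-corner pencil
`∑_l X^{d_l} [[ε₁u_l + ε₂w_l, α_l, β_l], [α_l, u_l, 0], [β_l, 0, w_l]]` (`det = uw(ε₁u + ε₂w) − α²w − β²u`) has `≤ 18` distinct positive
det-roots.  Three classes: `(1,1)` = R4 (`det = ½·e₃(u−α, u+α, w−β, w+β)`), `(1,−1) ~ (−1,1)` = R2, `(−1,−1)` = R0.  Nothing is bounded
here. [folklore] -/
theorem posRootLawOn_iff_signedHollowCornerRows (d : Fin 4 → ℕ) :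
    PosRootLawOn 3 4 18 d ↔
      ∀ (ε₁ ε₂ : ℝ) (u w α β : Fin 4 → ℝ), (ε₁ = 1 ∨ ε₁ = -1) → (ε₂ = 1 ∨ ε₂ = -1) →
        ((Matrix.det (∑ l, ((Polynomial.X : Polynomial ℝ) ^ d l) •
            (!![ε₁ * u l + ε₂ * w l, α l, β l; α l, u l, 0; β l, 0, w l] : Matrix (Fin 3) (Fin 3) ℝ).map
              Polynomial.C)).roots.toFinset.filter (fun t => 0 < t)).card ≤ 18 := by
  constructor
  · intro h ε₁ ε₂ u w α β _ _
    exact hollowCorner_rows_of_posRootLawOn d h ε₁ ε₂ u w α β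
  · intro hHC
    obtain ⟨Θ, hΘ₀, hΘ⟩ := exists_congr_signedHollowCorner
    refine posRootLawOn_of_rows_off_hypersurface d Θ hΘ₀ fun S hS hne => ?_
    obtain ⟨P, ε₁, ε₂, u, w, α, β, hP, hε₁, hε₂, hSP⟩ := hΘ S hS hne
    have hfun : S = fun l => Pᵀ * !![ε₁ * u l + ε₂ * w l, α l, β l; α l, u l, 0; β l, 0, w l] * P := funext hSP
    rw [hfun, card_posRoots_congr d _ Pᵀ P (by rwa [det_transpose]) hP]
    exact hHC ε₁ ε₂ u w α β hε₁ hε₂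

/-- **`DoorA34` IS THE CONJUNCTION OF THE ROWS OF THE THREE GENERIC NODE CLASSES.**  The cell's typed target `DoorA34 = PosRootLawAt 3 4 18`
(`Iff.rfl`-equal to the route item `Theses.LacunarySymmetroid.DoorA34`, stmt-ValiantsHypothesis-19980) holds IF AND ONLY IF on every support
`d`, for all SIGNS `ε₁, ε₂ ∈ {1, −1}` (no isotropic class) and all `u, w, α, β : Fin 4 → ℝ`, the hollow-corner pencil
`∑_l X^{d_l} [[ε₁u_l + ε₂w_l, α_l, β_l], [α_l, u_l, 0], [β_l, 0, w_l]]` has `≤ 18` distinct positive det-roots — `…HollowCornerSplit`'s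
`doorA34_iff_hollowCornerRows` with the five isotropic sign classes removed.  `DoorA34` stays OPEN. [folklore] -/
theorem doorA34_iff_signedHollowCornerRows :
    DoorA34 ↔
      ∀ (d : Fin 4 → ℕ) (ε₁ ε₂ : ℝ) (u w α β : Fin 4 → ℝ), (ε₁ = 1 ∨ ε₁ = -1) → (ε₂ = 1 ∨ ε₂ = -1) →
        ((Matrix.det (∑ l, ((Polynomial.X : Polynomial ℝ) ^ d l) •
            (!![ε₁ * u l + ε₂ * w l, α l, β l; α l, u l, 0; β l, 0, w l] : Matrix (Fin 3) (Fin 3) ℝ).map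
              Polynomial.C)).roots.toFinset.filter (fun t => 0 < t)).card ≤ 18 := by
  constructor
  · intro h d
    exact (posRootLawOn_iff_signedHollowCornerRows d).mp (h d)
  · intro h d
    exact (posRootLawOn_iff_signedHollowCornerRows d).mpr (h d)

/-- **Refutation currency**: `DoorA34` fails iff SOME signed hollow-corner pencil (`εᵢ = ±1`) on SOME support has `≥ 19` distinct positive
det-roots. [folklore] -/
theorem not_doorA34_iff_signedHollowCornerNineteen :
    ¬ DoorA34 ↔
      ∃ (d : Fin 4 → ℕ) (ε₁ ε₂ : ℝ) (u w α β : Fin 4 → ℝ), (ε₁ = 1 ∨ ε₁ = -1) ∧ (ε₂ = 1 ∨ ε₂ = -1) ∧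
        19 ≤ ((Matrix.det (∑ l, ((Polynomial.X : Polynomial ℝ) ^ d l) •
            (!![ε₁ * u l + ε₂ * w l, α l, β l; α l, u l, 0; β l, 0, w l] : Matrix (Fin 3) (Fin 3) ℝ).map
              Polynomial.C)).roots.toFinset.filter (fun t => 0 < t)).card := by
  rw [doorA34_iff_signedHollowCornerRows]
  push Not
  constructor
  · rintro ⟨d, ε₁, ε₂, u, w, α, β, h₁, h₂, hlt⟩
    exact ⟨d, ε₁, ε₂, u, w, α, β, h₁, h₂, by omega⟩
  · rintro ⟨d, ε₁, ε₂, u, w, α, β, h₁, h₂, hle⟩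
    exact ⟨d, ε₁, ε₂, u, w, α, β, h₁, h₂, by omega⟩

end Signed

end Summit.ValiantsHypothesis.ValiantsHypothesis.Theorems.LacunarySymmetroidMatrixDescartes.Census.EqualDiagonal
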